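import Literature.Analysis.FluidPDE.TypeIAncientMild
import Literature.Analysis.FluidPDE.KNSSTypeIRateLiouvilleHolds
import Literature.Analysis.FluidPDE.AxisymmetricHeatFlow
import Literature.Analysis.FluidPDE.OseenKernelLineIntegrals
import Summits.NavierStokesRegularity.NavierStokesRegularity.Theorems.SymmetricLiouville.Negative.LoadBearing
import Summits.NavierStokesRegularity.NavierStokesRegularity.Theorems.SqueezeCycleExtremalBiaxialitySubcriticalSmallConstant

/-!
# Disproof workfile — crux `HelicalEndLiouville` (stmt-NavierStokesRegularity-14062)

Standing disprover (cdisprove) of route `SymmetryModuliCount`, item #7. The crux: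

  `∀ C u, IsTypeIAncientMild C u → ∀ a A θ, A skew → a ∉ range A → θ ≤ 0 →`
  `(∀ t < θ, ∀ x, fderiv ℝ (u t) x (a + A x) − A (u t x) = 0) → ∀ t < θ, ∀ x, u t x = 0`

i.e. a Type-I ancient mild field (KNSS/Oseen gauge) annihilated on a backward end by a Killing
generator with nonzero translation part along `ker A` (a translation, `A = 0`, or a screw motion of
nonzero pitch) vanishes on that end.

## Findings (cycle 1, 2026-08-16)

* **No kill.** The class `IsTypeIAncientMild` is faithful (absolutely convergent Oseen/heat
  integrals for bounded continuous slices, true derivatives on the open slab, skewness and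
  `a ∉ range A` mean what they say; §0 read-back), so a counter-model is a NONZERO screw-symmetric
  Type-I ancient mild solution — a counterexample to the Liouville statement (L') itself; none is
  known (KNSS 2009 §6; Bradshaw–Tsai OP 5.1; Lei–Ren–Zhang 2019 Thm 1.1 is the nearest printed
  periodic Liouville theorem). Formally (§3): the crux and EVERY mutant that keeps `u ∈ A_C` is a
  corollary of `TypeIAncientLiouville` (X), so nothing in-class is refutable short of refuting X.
* **§1 Load-bearing hypotheses (all kernel-checked, sorry-free):**
  - (a) the Oseen/KNSS gauge: FALSE without it (parasitic `(1−t)⁻¹ f₀`), and FALSE if it holds only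
    between times of a final window (faded constant) — mildness must reach `t = −∞`;
  - (b) the Type-I DECAY at `t = −∞`: FALSE with decay dropped, FALSE with boundedness of the whole
    past plus Type-I on `(−1,0)` (constants are in the gauge class), and the genuinely HELICAL branch
    (`A = J ≠ 0` the rotation generator about `e_z`, `a = e_z ∈ ker J`) is killed by the constant
    `e_z` just the same — so a "bounded helical ancient Liouville" theorem can at best conclude
    `u = const ∈ ker A`;
  - (c) ancientness: FALSE on every finite backward window (viscous shear wave, an exact NS solution,
    translation invariant along `e₁`, Type-I on the window, growing like `e^{4π²|t|}`);
  - (d) `θ ≤ 0`: FALSE without it, but only through the junk region `t ≥ 0` where the class says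
    nothing (step witness) — harmless, tells the prover where the hypothesis enters;
  - (e) `a ∉ range A`: dropping it admits `ξ = 0` and the mutant is LITERALLY EQUIVALENT to X
    (`withoutNotInRange_iff_typeIAncientLiouville`); keeping `(a, A) ≠ 0` but allowing
    `a ∈ range A` adds exactly the axisymmetric leaf (item 14061). Load-bearing as a case split only.
  - smoothness is NOT load-bearing (a theorem for bounded mild fields, KNSS Prop 4.1 =
    `knss2009_smoothing`); divergence-freeness could not be isolated by an explicit witness.
* **§4 What is already provable (positive, evidence only — attached as `Positive.lean`):**
  (i) **THE WHOLE TRANSLATIONAL CASE `A = 0` OF THE CRUX IS PROVED** here, sorry-free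
  (`helicalEndLiouvilleLocal_translation_case`): along `x₂` it is a corollary of the PROVED tree
  theorem `KNSS2009_typeI_rate_liouville_holds` (`translationLeaf_axis1`: shift into the past to make
  the field bounded, integrate the infinitesimal symmetry along lines); a general direction `a ≠ 0`
  is rotated onto `‖a‖e₂` by a Householder reflection, using the ROTATION COVARIANCE OF `A_C` proved
  here (`oseenKernel_map`: `K(τ,Lz)[La,Lb] = L·K(τ,z)[a,b]`, `oseenDuhamel_conjField`, `heatFlow_conj`,
  `isDivFree_conj`, `isTypeIAncientMild_conjField`). (ii) The route's "Kato gap" is the tree theorem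
  `exists_typeIAncientMild_eq_zero_of_small` shifted onto an end (`gap_dichotomy_on_end`): a nonzero
  element has `limsup_{t→−∞} √(−t)‖u(t)‖_∞ ≥ ε`. Hence what is OPEN of the crux is exactly the
  helical branch `A ≠ 0`, and of it exactly the zoom-out/compactness step (KNSS Lemma 6.1 for `A_C`:
  the rescalings `λu(λ²s, x_n+λy)` stay in `A_C` by `oseen_smul_stPull` + `oseenDuhamel_comp_add_right`,
  the limit is translation invariant along the axis and dies by (i)). No obstruction was found.

Tree pieces for the prover's remaining assembly (found by `lean search`, not used here):
parabolic scaling covariance of the Oseen term `oseenDuhamel_smul_stPull` / `oseen_smul_stPull`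
and `heatExtension_smul_stPull` (`KNSSTypeIRateMildProofs`), space translation
`oseenDuhamel_comp_add_right` (`KNSSOseenMildDecayTools`), `heatExtension_comp_linearIsometryEquiv`
(`AxisymmetricHeatFlow`), `heatKernel_eq_of_norm_eq` (`OseenKernelLineIntegrals`), time shift
`IsTypeIAncientMild.comp_sub_right`; MISSING: `oseenDuhamel` under linear isometries (rotation
covariance of `A_C`) and a KNSS Lemma 6.1-type compactness/mild-closure statement for `A_C`
(cf. the coarse fact `KNSS2009_typeI_rate_compactness` and the proved chain in `KNSSBlowupLimit`).

Farm note: the check-farm build of `Theses/SymmetryModuliCount` predates rev 5 (no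
`HelicalEndLiouville` constant yet), so this file works over the verbatim copy
`HelicalEndLiouvilleLocal`; `Iff.rfl` bridges once the module is rebuilt.
-/

noncomputable section

namespace Summit.NavierStokesRegularity.NavierStokesRegularity.Cruxes.HelicalEndLiouville.Disproof

open Literature.Analysis.FluidPDE MeasureTheory Set Function Real
open scoped RealInnerProductSpace
open Summit.NavierStokesRegularity.NavierStokesRegularity.Theses.SymmetryModuliCount
  (TypeIAncientLiouville)
open Summit.NavierStokesRegularity.NavierStokesRegularity.Theorems.SymmetricLiouville.Negative

/-! ## Rotation covariance of the Oseen class (generic inner-product space; used in §4) -/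

section General


variable {E : Type*} [NormedAddCommGroup E] [InnerProductSpace ℝ E] [FiniteDimensional ℝ E]
  [MeasurableSpace E] [BorelSpace E]

omit [FiniteDimensional ℝ E] [MeasurableSpace E] [BorelSpace E] in
/-- The second Gaussian weight is radial. -/
theorem oseenWeightB_eq_of_norm_eq {x y : E} (h : ‖x‖ = ‖y‖) (τ : ℝ) :
    oseenWeightB τ x = oseenWeightB τ y := by
  simp [oseenWeightB, heatKernel_eq_of_norm_eq h]

omit [FiniteDimensional ℝ E] [MeasurableSpace E] [BorelSpace E] in
/-- **The Oseen–Koch–Tataru kernel is rotation covariant**: `K(τ, Lz)[La, Lb] = L K(τ, z)[a, b]`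
for a linear isometry `L` (the closed form is built from inner products and radial weights). -/
theorem oseenKernel_map (L : E ≃ₗᵢ[ℝ] E) (τ : ℝ) (z a b : E) :
    oseenKernel τ (L z) (L a) (L b) = L (oseenKernel τ z a b) := by
  have hn : ‖L z‖ = ‖z‖ := L.norm_map z
  simp only [oseenKernel, LinearIsometryEquiv.inner_map_map, heatKernel_eq_of_norm_eq hn,
    oseenWeightA_eq_of_norm_eq hn, oseenWeightB_eq_of_norm_eq hn, map_add, map_sub,
    LinearIsometryEquiv.map_smul]

/-- The conjugate field `(L · u)(t, y) = L u(t, L⁻¹ y)`. -/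
def conjField (L : E ≃ₗᵢ[ℝ] E) (u : ℝ → E → E) : ℝ → E → E := fun t y => L (u t (L.symm y))

omit [FiniteDimensional ℝ E] [MeasurableSpace E] [BorelSpace E] in
@[simp] theorem conjField_apply (L : E ≃ₗᵢ[ℝ] E) (u : ℝ → E → E) (t : ℝ) (y : E) :
    conjField L u t y = L (u t (L.symm y)) := rfl

omit [FiniteDimensional ℝ E] [MeasurableSpace E] [BorelSpace E] in
/-- A linear isometry commutes with the Bochner integral (no integrability needed). -/
theorem integral_comp_comm_lie {X : Type*} [MeasurableSpace X] (μ : Measure X) (L : E ≃ₗᵢ[ℝ] E)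
    (f : X → E) : ∫ x, L (f x) ∂μ = L (∫ x, f x ∂μ) :=
  L.toContinuousLinearEquiv.integral_comp_comm f

/-- **The Oseen–Duhamel term is rotation covariant**:
`B^ν_s(L·u, L·v)(t)(x) = L · B^ν_s(u, v)(t)(L⁻¹x)`. -/
theorem oseenDuhamel_conjField (L : E ≃ₗᵢ[ℝ] E) (ν s : ℝ) (u v : ℝ → E → E) (t : ℝ) (x : E) :
    oseenDuhamel ν s (conjField L u) (conjField L v) t x =
      L (oseenDuhamel ν s u v t (L.symm x)) := by
  simp only [oseenDuhamel_apply, conjField_apply]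
  rw [← integral_comp_comm_lie]
  refine setIntegral_congr_fun measurableSet_Ioo fun τ _ => ?_
  rw [← integral_comp_comm_lie]
  have hmp : MeasurePreserving L volume volume := L.measurePreserving
  rw [← hmp.integral_comp L.toHomeomorph.measurableEmbedding
    (fun y => oseenKernel (ν * (t - τ)) (x - y) (L (u τ (L.symm y))) (L (v τ (L.symm y))))]
  congr 1
  funext y
  have e : x - L y = L (L.symm x - y) := by simp [map_sub]
  simp only [LinearIsometryEquiv.symm_apply_apply]
  rw [e, oseenKernel_map]

/-- **The heat flow is rotation covariant**: `e^{σΔ}(L·φ)(x) = L · (e^{σΔ}φ)(L⁻¹x)`. -/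
theorem heatFlow_conj (L : E ≃ₗᵢ[ℝ] E) (φ : E → E) (σ : ℝ) (x : E) :
    heatFlow (fun y => L (φ (L.symm y))) σ x = L (heatFlow φ σ (L.symm x)) := by
  rcases le_or_gt σ 0 with h | h
  · simp [heatFlow_of_nonpos _ h]
  · rw [heatFlow_of_pos _ h, heatFlow_of_pos _ h,
      heatExtension_comp_linearIsometryEquiv L.symm (fun z => L (φ z)) σ x]
    have e : (fun z => L (φ z)) = fun z => L.toContinuousLinearEquiv (φ z) := rfl
    rw [e, heatExtension_continuousLinearEquiv_comp]
    rfl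

omit [FiniteDimensional ℝ E] [MeasurableSpace E] [BorelSpace E] in
/-- Divergence is invariant under conjugation by a linear isometry (trace of a conjugate). -/
theorem divergence_conj (L : E ≃ₗᵢ[ℝ] E) {φ : E → E} (hd : Differentiable ℝ φ) (x : E) :
    VectorCalculus.divergence (fun y => L (φ (L.symm y))) x =
      VectorCalculus.divergence φ (L.symm x) := by
  unfold VectorCalculus.divergence
  have hA : HasFDerivAt (fun y : E => L.symm y) (L.symm.toContinuousLinearEquiv : E →L[ℝ] E) x :=
    L.symm.toContinuousLinearEquiv.hasFDerivAt
  have hB : HasFDerivAt φ (fderiv ℝ φ (L.symm x)) (L.symm x) := (hd _).hasFDerivAt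
  have hC : HasFDerivAt (fun z : E => L z) (L.toContinuousLinearEquiv : E →L[ℝ] E) (φ (L.symm x)) :=
    L.toContinuousLinearEquiv.hasFDerivAt
  have hcomp : HasFDerivAt (fun y => L (φ (L.symm y)))
      ((L.toContinuousLinearEquiv : E →L[ℝ] E).comp ((fderiv ℝ φ (L.symm x)).comp
        (L.symm.toContinuousLinearEquiv : E →L[ℝ] E))) x :=
    (hC.comp (L.symm x) hB).comp x hA
  rw [hcomp.fderiv]
  have key : ((L.toContinuousLinearEquiv : E →L[ℝ] E).comp ((fderiv ℝ φ (L.symm x)).comp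
      (L.symm.toContinuousLinearEquiv : E →L[ℝ] E)) : E →ₗ[ℝ] E) =
      L.toLinearEquiv.conj (fderiv ℝ φ (L.symm x) : E →ₗ[ℝ] E) := by
    ext v
    simp [LinearEquiv.conj_apply]
  rw [key, LinearMap.trace_conj']

omit [FiniteDimensional ℝ E] [MeasurableSpace E] [BorelSpace E] in
/-- A divergence-free differentiable field stays divergence free under conjugation. -/
theorem isDivFree_conj (L : E ≃ₗᵢ[ℝ] E) {φ : E → E} (hφ : VectorCalculus.IsDivFree φ)
    (hd : Differentiable ℝ φ) : VectorCalculus.IsDivFree (fun y => L (φ (L.symm y))) := by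
  intro x
  rw [divergence_conj L hd x]
  exact hφ _

/-- **`A_C` is rotation invariant**: `IsTypeIAncientMild C u → IsTypeIAncientMild C (L·u)`. -/
theorem isTypeIAncientMild_conjField {C : ℝ} {u : ℝ → E → E} (h : IsTypeIAncientMild C u)
    (L : E ≃ₗᵢ[ℝ] E) : IsTypeIAncientMild C (conjField L u) := by
  refine ⟨?_, fun t ht => ?_, fun s t hst ht x => ?_, fun t ht x => ?_⟩
  · -- joint smoothness
    have e : uncurry (conjField L u) =
        (fun z : E => L.toContinuousLinearEquiv z) ∘ uncurry u ∘
          fun p : ℝ × E => (p.1, L.symm.toContinuousLinearEquiv p.2) := by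
      funext p; rfl
    rw [e]
    refine L.toContinuousLinearEquiv.contDiff.comp_contDiffOn (h.1.comp ?_ ?_)
    · exact (contDiff_fst.prodMk (L.symm.toContinuousLinearEquiv.contDiff.comp contDiff_snd)).contDiffOn
    · intro p hp
      exact ⟨hp.1, mem_univ _⟩
  · -- divergence free
    have hd : Differentiable ℝ (u t) := (h.contDiff_slice ht).differentiable (by simp)
    show VectorCalculus.IsDivFree (fun y => L (u t (L.symm y)))
    exact isDivFree_conj L (h.isDivFree ht) hd
  · -- the Oseen identity
    rw [oseenDuhamel_conjField, conjField_apply, h.mild_eq hst ht (L.symm x), map_sub]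
    congr 1
    rw [← heatFlow_conj L (u s) (t - s) x]
    rfl
  · -- Type I
    rw [conjField_apply, LinearIsometryEquiv.norm_map]
    exact h.norm_le ht _

end General

local notation "ℝ³" => EuclideanSpace ℝ (Fin 3)

/-! ## §0 The crux verbatim, its clauses, and the sandwich `translational leaf ≤ crux ≤ X` -/

/-- Verbatim local copy of the route decl `SymmetryModuliCount.HelicalEndLiouville` (rev 5). -/
def HelicalEndLiouvilleLocal : Prop :=
  ∀ (C : ℝ) (u : ℝ → EuclideanSpace ℝ (Fin 3) → EuclideanSpace ℝ (Fin 3)),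
    Literature.Analysis.FluidPDE.IsTypeIAncientMild C u →
    ∀ (a : EuclideanSpace ℝ (Fin 3)) (A : EuclideanSpace ℝ (Fin 3) →L[ℝ] EuclideanSpace ℝ (Fin 3))
      (θ : ℝ), (∀ x, inner ℝ (A x) x = 0) → a ∉ Set.range A → θ ≤ 0 →
      (∀ t < θ, ∀ x, fderiv ℝ (u t) x (a + A x) - A (u t x) = 0) → ∀ t < θ, ∀ x, u t x = 0

/-- The Killing-symmetry clause on the end `t < θ`: `(a + Ax)·∇u = Au`. -/
def HasKillingSymmetryBefore (u : ℝ → ℝ³ → ℝ³) (a : ℝ³) (A : ℝ³ →L[ℝ] ℝ³) (θ : ℝ) : Prop :=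
  ∀ t < θ, ∀ x, fderiv ℝ (u t) x (a + A x) - A (u t x) = 0

/-- The conclusion: `u ≡ 0` on the end `t < θ`. -/
def VanishesBefore (u : ℝ → ℝ³ → ℝ³) (θ : ℝ) : Prop := ∀ t < θ, ∀ x, u t x = 0

/-- The crux unbundled (`Iff.rfl`). -/
theorem helicalEndLiouvilleLocal_iff : HelicalEndLiouvilleLocal ↔
    ∀ (C : ℝ) (u : ℝ → ℝ³ → ℝ³), IsTypeIAncientMild C u →
      ∀ (a : ℝ³) (A : ℝ³ →L[ℝ] ℝ³) (θ : ℝ), IsSkew A → a ∉ Set.range A → θ ≤ 0 →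
        HasKillingSymmetryBefore u a A θ → VanishesBefore u θ :=
  Iff.rfl

/-- `0` is skew. -/
theorem isSkew_zero : IsSkew (0 : ℝ³ →L[ℝ] ℝ³) := fun x => by simp

/-- A nonzero vector is not in the range of the zero map (the translation case `A = 0`). -/
theorem not_mem_range_zero {a : ℝ³} (ha : a ≠ 0) : a ∉ Set.range ((0 : ℝ³ →L[ℝ] ℝ³) : ℝ³ → ℝ³) := by
  rintro ⟨y, hy⟩
  exact ha (by simpa using hy.symm)

/-- Spatially constant slices are Killing-symmetric under every translation `(a, 0)`. -/
theorem killing_translation_of_spatially_const (b : ℝ → ℝ³) (a : ℝ³) (θ : ℝ) :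
    HasKillingSymmetryBefore (fun t _ => b t) a 0 θ := fun t _ x => by
  simp

/-- **Crux ≤ X.** `TypeIAncientLiouville` implies the crux outright (it kills every element of
`A_C` on all of `t < 0 ⊇ {t < θ}`); so any refutation of the crux refutes the route target. -/
theorem helicalEndLiouvilleLocal_of_typeIAncientLiouville (hX : TypeIAncientLiouville) :
    HelicalEndLiouvilleLocal := by
  intro C u hu a A θ _ _ hθ _ t ht x
  exact hX C u (isTypeIAncientMild_iff.1 hu) t (lt_of_lt_of_le ht hθ) x

/-- Contrapositive, negative-lane form: a kill of the crux is a kill of X. -/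
theorem not_typeIAncientLiouville_of_not_helicalEndLiouvilleLocal (h : ¬ HelicalEndLiouvilleLocal) :
    ¬ TypeIAncientLiouville :=
  fun hX => h (helicalEndLiouvilleLocal_of_typeIAncientLiouville hX)

/-! ## §1 Load-bearing hypotheses

Every witness below is a field with an exact translation or screw symmetry that satisfies all but
ONE clause of the class `A_C = {IsTypeIAncientMild C ·}`; "any proof must use that clause". -/

/-! ### (a) The Oseen / KNSS gauge -/

/-- The crux with the Oseen integral equation DROPPED (smooth, divergence free, Type-I kept). -/
def HelicalEndLiouvilleWithoutMild : Prop :=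
  ∀ (C : ℝ) (u : ℝ → ℝ³ → ℝ³),
    ContDiffOn ℝ (⊤ : ℕ∞) (uncurry u) (Iio 0 ×ˢ univ) → (∀ t < 0, VectorCalculus.IsDivFree (u t)) →
    HasTypeITimeDecay C u →
    ∀ (a : ℝ³) (A : ℝ³ →L[ℝ] ℝ³) (θ : ℝ), IsSkew A → a ∉ Set.range A → θ ≤ 0 →
      HasKillingSymmetryBefore u a A θ → VanishesBefore u θ

/-- **The gauge is load-bearing**: without the Oseen integral equation the crux is false — the
parasitic field `(1 − t)⁻¹ • f₀` (KNSS 2009 §1: `u = b(t)`, `∇p = −b'·x`, removed by the mild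
formulation) is smooth, divergence free, Type-I with `C = 1`, invariant under the translation
`(f₀, 0)`, and nonzero at `t = −1`. -/
theorem helicalEndLiouville_false_without_mild : ¬ HelicalEndLiouvilleWithoutMild := fun h =>
  parasiticField_not_vanishes (h 1 parasiticField parasiticField_smooth parasiticField_divFree
    parasiticField_typeI f0 0 0 isSkew_zero (not_mem_range_zero f0_ne_zero) le_rfl
    (killing_translation_of_spatially_const (fun t => (1 - t)⁻¹ • f0) f0 0))

/-- The crux with the Oseen integral equation assumed only between times of a FINAL WINDOW
`(−T, 0)` (smoothness, divergence, Type-I on all `t < 0`, symmetry on the end, verbatim). -/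
def HelicalEndLiouvilleMildOnWindow (T : ℝ) : Prop :=
  ∀ (C : ℝ) (u : ℝ → ℝ³ → ℝ³),
    ContDiffOn ℝ (⊤ : ℕ∞) (uncurry u) (Iio 0 ×ˢ univ) → (∀ t < 0, VectorCalculus.IsDivFree (u t)) →
    (∀ s t : ℝ, -T < s → s < t → t < 0 → ∀ x, u t x = heatFlow (u s) (t - s) x -
        ∫ τ in Ioo s t, ∫ y, oseenKernel (t - τ) (x - y) (u τ y) (u τ y)) →
    HasTypeITimeDecay C u →
    ∀ (a : ℝ³) (A : ℝ³ →L[ℝ] ℝ³) (θ : ℝ), IsSkew A → a ∉ Set.range A → θ ≤ 0 →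
      HasKillingSymmetryBefore u a A θ → VanishesBefore u θ

/-- The faded constant is Type-I on all of `t < 0` with `C = √(2T)` (it vanishes for `t ≤ −2T`). -/
theorem fadedConst_typeI {T : ℝ} (hT : 0 < T) : HasTypeITimeDecay (Real.sqrt (2 * T)) (fadedConst T) := by
  intro t ht x
  have hst : 0 < Real.sqrt (-t) := Real.sqrt_pos.2 (by linarith)
  rcases le_or_gt t (-(2 * T)) with h2 | h2
  · have : fadedConst T t x = 0 := by simp [fadedConst, fade_eq_zero hT h2]
    rw [this, norm_zero]
    positivity
  · have hle : Real.sqrt (-t) ≤ Real.sqrt (2 * T) := Real.sqrt_le_sqrt (by linarith)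
    rw [le_div_iff₀ hst]
    have hn : ‖fadedConst T t x‖ ≤ 1 := by
      simp only [fadedConst, norm_smul, norm_ez, mul_one, Real.norm_eq_abs,
        abs_of_nonneg (fade_mem_Icc T t).1]
      exact (fade_mem_Icc T t).2
    calc ‖fadedConst T t x‖ * Real.sqrt (-t) ≤ 1 * Real.sqrt (2 * T) := by gcongr
      _ = Real.sqrt (2 * T) := one_mul _

/-- **The gauge must reach back to `t = −∞`**: for every `T > 0` the window-mild mutant is false —
the faded constant `φ_T(t) • e_z` (`1` on `[−T, 0)`, `0` for `t ≤ −2T`) is smooth, divergence free,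
Type-I on all `t < 0`, translation invariant, satisfies the Oseen equation between any two times of
the window (where it is the constant `e_z`, which IS in the gauge class), yet `u(−T/2) = e_z ≠ 0`.
It is not in `A_C`: between `s < −2T` and `t > −T` the equation fails. -/
theorem helicalEndLiouville_false_mild_on_window {T : ℝ} (hT : 0 < T) :
    ¬ HelicalEndLiouvilleMildOnWindow T := by
  intro h
  have hval : ∀ t, -T ≤ t → ∀ x : ℝ³, fadedConst T t x = ez := fun t ht x => by
    simp [fadedConst, fade_eq_one hT ht]
  have key := h (Real.sqrt (2 * T)) (fadedConst T) (fadedConst_contDiff T).contDiffOn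
    (fun t _ => isDivFree_fun_const _) ?_ (fadedConst_typeI hT) ez 0 0 isSkew_zero
    (not_mem_range_zero ez_ne_zero) le_rfl
    (killing_translation_of_spatially_const (fun t => fade T t • ez) ez 0) (-T / 2) (by linarith) 0
  · rw [hval (-T / 2) (by linarith)] at key
    exact ez_ne_zero key
  · intro s t hs hst _ x
    have hus : fadedConst T s = fun _ : ℝ³ => ez := funext (hval s hs.le)
    rw [hval t (by linarith) x, hus]
    have hD : ∫ τ in Ioo s t, ∫ y, oseenKernel (t - τ) (x - y) (fadedConst T τ y)
        (fadedConst T τ y) = ∫ τ in Ioo s t, ∫ y, oseenKernel (t - τ) (x - y) ez ez := by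
      refine setIntegral_congr_fun measurableSet_Ioo fun τ hτ => ?_
      have hτ' : -T ≤ τ := by linarith [hτ.1]
      simp only [hval τ hτ']
    rw [hD]
    exact const_mild ez hst x

/-! ### (b) The Type-I decay at `t = −∞` -/

/-- The crux with the Type-I hypothesis DROPPED (smooth, divergence free, KNSS-mild kept). -/
def HelicalEndLiouvilleWithoutTypeI : Prop :=
  ∀ (u : ℝ → ℝ³ → ℝ³),
    ContDiffOn ℝ (⊤ : ℕ∞) (uncurry u) (Iio 0 ×ˢ univ) → (∀ t < 0, VectorCalculus.IsDivFree (u t)) →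
    (∀ s t : ℝ, s < t → t < 0 → ∀ x, u t x = heatFlow (u s) (t - s) x -
        ∫ τ in Ioo s t, ∫ y, oseenKernel (t - τ) (x - y) (u τ y) (u τ y)) →
    ∀ (a : ℝ³) (A : ℝ³ →L[ℝ] ℝ³) (θ : ℝ), IsSkew A → a ∉ Set.range A → θ ≤ 0 →
      HasKillingSymmetryBefore u a A θ → VanishesBefore u θ

/-- **Type-I decay is load-bearing**: the constant field `f₀` is smooth, divergence free, KNSS-mild
(`e^{σΔ}c = c`, `∫K(σ,x−y)[c,c]dy = 0`: constants ARE in the gauge class, KNSS 2009 Rem. 6.1) and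
translation invariant, yet nonzero. -/
theorem helicalEndLiouville_false_without_typeI : ¬ HelicalEndLiouvilleWithoutTypeI := fun h =>
  constField_not_vanishes (h constField constField_smooth constField_divFree constField_mild
    f0 0 0 isSkew_zero (not_mem_range_zero f0_ne_zero) le_rfl
    (killing_translation_of_spatially_const (fun _ => f0) f0 0))

/-- The crux with Type-I assumed only on the final window `(−1, 0)` plus BOUNDEDNESS of the whole
past (all other clauses verbatim). More hypotheses than `HelicalEndLiouvilleWithoutTypeI`. -/
def HelicalEndLiouvilleTypeINearZeroBoundedPast : Prop :=
  ∀ (C : ℝ) (u : ℝ → ℝ³ → ℝ³),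
    ContDiffOn ℝ (⊤ : ℕ∞) (uncurry u) (Iio 0 ×ˢ univ) → (∀ t < 0, VectorCalculus.IsDivFree (u t)) →
    (∀ s t : ℝ, s < t → t < 0 → ∀ x, u t x = heatFlow (u s) (t - s) x -
        ∫ τ in Ioo s t, ∫ y, oseenKernel (t - τ) (x - y) (u τ y) (u τ y)) →
    (∀ t ∈ Ioo (-1 : ℝ) 0, ∀ x, ‖u t x‖ ≤ C / Real.sqrt (-t)) → (∀ t < 0, ∀ x, ‖u t x‖ ≤ C) →
    ∀ (a : ℝ³) (A : ℝ³ →L[ℝ] ℝ³) (θ : ℝ), IsSkew A → a ∉ Set.range A → θ ≤ 0 →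
      HasKillingSymmetryBefore u a A θ → VanishesBefore u θ

/-- The constant field `f₀` is Type-I with `C = 1` on the final window `(−1, 0)` (`√(−t) ≤ 1`). -/
theorem constField_typeI_near_zero :
    ∀ t ∈ Ioo (-1 : ℝ) 0, ∀ x : ℝ³, ‖constField t x‖ ≤ 1 / Real.sqrt (-t) := by
  rintro t ⟨ht1, ht2⟩ x
  have hs : 0 < Real.sqrt (-t) := Real.sqrt_pos.2 (by linarith)
  have hs1 : Real.sqrt (-t) ≤ 1 := by
    rw [Real.sqrt_le_left zero_le_one]
    linarith
  rw [le_div_iff₀ hs]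
  simpa [constField, norm_f0] using hs1

/-- **It is the DECAY `‖u(t)‖_∞ → 0` as `t → −∞` that is used**, not the rate near `t = 0` and not
boundedness: Type-I on `(−1,0)` plus a bounded past does not suffice (constant field `f₀`). Hence a
bounded-ancient helical/periodic Liouville theorem can conclude at best "`u` is constant". -/
theorem helicalEndLiouville_false_typeI_near_zero_bounded_past :
    ¬ HelicalEndLiouvilleTypeINearZeroBoundedPast := fun h =>
  constField_not_vanishes (h 1 constField constField_smooth constField_divFree constField_mild
    constField_typeI_near_zero constField_bounded f0 0 0 isSkew_zero (not_mem_range_zero f0_ne_zero)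
    le_rfl (killing_translation_of_spatially_const (fun _ => f0) f0 0))

/-! #### The genuinely helical branch (`A ≠ 0`, nonzero pitch) is killed by the same constants -/

/-- The rotation generator about the `e_z`-axis: `J x = x₀ e₁ − x₁ f₀` (`= e_z × x`). -/
def J : ℝ³ →L[ℝ] ℝ³ := (innerSL ℝ f0).smulRight e1 - (innerSL ℝ e1).smulRight f0

/-- `J x = ⟪f₀, x⟫ e₁ − ⟪e₁, x⟫ f₀`. -/
theorem J_apply (x : ℝ³) : J x = ⟪f0, x⟫ • e1 - ⟪e1, x⟫ • f0 := by
  simp [J, ContinuousLinearMap.smulRight_apply]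

/-- `J` is skew. -/
theorem isSkew_J : IsSkew J := by
  intro x
  rw [J_apply, inner_sub_left, inner_smul_left, inner_smul_left]
  simp only [conj_trivial]
  rw [real_inner_comm x e1, real_inner_comm x f0]
  ring

/-- `J e_z = 0`: `e_z` spans `ker J` (the screw axis). -/
theorem J_ez : J ez = 0 := by
  rw [J_apply]
  simp [f0, e1, ez, EuclideanSpace.inner_single_left]

/-- `J ≠ 0` (`J f₀ = e₁`). -/
theorem J_ne_zero : J ≠ 0 := by
  intro h
  have h1 : J f0 = e1 := by
    rw [J_apply]
    simp [f0, e1, EuclideanSpace.inner_single_left]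
  rw [h] at h1
  exact e1_ne_zero (by simpa using h1.symm)

/-- `e_z ∉ range J` (every `J y` has vanishing `e_z`-component): `(e_z, J)` is a screw generator of
NONZERO pitch, the helical case of the crux. -/
theorem ez_not_mem_range_J : ez ∉ Set.range (J : ℝ³ → ℝ³) := by
  rintro ⟨y, hy⟩
  have h2 : (J y) 2 = 0 := by
    rw [J_apply]
    simp [f0, e1]
  rw [hy] at h2
  simp [ez] at h2

/-- The constant field `e_z` has the exact screw symmetry `(e_z, J)`: `∇c = 0` and `J c = 0`. -/
theorem killing_screw_const_ez (θ : ℝ) : HasKillingSymmetryBefore (fun _ _ => ez) ez J θ := by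
  intro t _ x
  simp [J_ez]

/-- **Helical branch, decay dropped: false.** The constant field `e_z` (axis direction) is smooth,
divergence free, KNSS-mild and invariant under the screw motion generated by `(e_z, J)`, `J ≠ 0`,
`e_z ∉ range J`; so even restricted to nonzero-pitch screws the statement needs the decay, and a
bounded helical ancient Liouville theorem can conclude at best `u = c ∈ ker A`. -/
theorem helicalEndLiouville_false_without_typeI_helical_branch :
    ¬ (∀ (u : ℝ → ℝ³ → ℝ³),
        ContDiffOn ℝ (⊤ : ℕ∞) (uncurry u) (Iio 0 ×ˢ univ) → (∀ t < 0, VectorCalculus.IsDivFree (u t)) →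
        (∀ s t : ℝ, s < t → t < 0 → ∀ x, u t x = heatFlow (u s) (t - s) x -
            ∫ τ in Ioo s t, ∫ y, oseenKernel (t - τ) (x - y) (u τ y) (u τ y)) →
        ∀ (a : ℝ³) (A : ℝ³ →L[ℝ] ℝ³) (θ : ℝ), IsSkew A → A ≠ 0 → a ∉ Set.range A → θ ≤ 0 →
          HasKillingSymmetryBefore u a A θ → VanishesBefore u θ) := fun h =>
  ez_ne_zero (h (fun _ _ => ez) contDiffOn_const (fun _ _ => isDivFree_fun_const ez)
    (fun s t hst _ x => const_mild ez hst x) ez J 0 isSkew_J J_ne_zero ez_not_mem_range_J le_rfl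
    (killing_screw_const_ez 0) (-1) (by norm_num) 0)

/-! ### (c) Ancientness: the crux on a finite backward window is false -/

/-- The crux with "ancient" weakened to a FINITE backward window `(−T, 0)`: class hypotheses,
symmetry and conclusion only for times in the window. -/
def HelicalEndLiouvilleOnWindow (T : ℝ) : Prop :=
  ∀ (C : ℝ) (u : ℝ → ℝ³ → ℝ³),
    ContDiffOn ℝ (⊤ : ℕ∞) (uncurry u) (Ioo (-T) 0 ×ˢ univ) →
    (∀ t ∈ Ioo (-T) 0, VectorCalculus.IsDivFree (u t)) →
    (∀ s t : ℝ, -T < s → s < t → t < 0 → ∀ x, u t x = heatFlow (u s) (t - s) x -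
        ∫ τ in Ioo s t, ∫ y, oseenKernel (t - τ) (x - y) (u τ y) (u τ y)) →
    (∀ t ∈ Ioo (-T) 0, ∀ x, ‖u t x‖ ≤ C / Real.sqrt (-t)) →
    ∀ (a : ℝ³) (A : ℝ³ →L[ℝ] ℝ³) (θ : ℝ), IsSkew A → a ∉ Set.range A → θ ≤ 0 →
      (∀ t ∈ Ioo (-T) θ, ∀ x, fderiv ℝ (u t) x (a + A x) - A (u t x) = 0) →
      ∀ t ∈ Ioo (-T) θ, ∀ x, u t x = 0

/-- The shear wave is Type-I on the window `(−T, 0)` with `C = e^{4π²T} √T`. -/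
theorem shearWave_typeI_on_window {T : ℝ} :
    ∀ t ∈ Ioo (-T) 0, ∀ y : ℝ³,
      ‖shearWave t y‖ ≤ Real.exp (4 * π ^ 2 * T) * Real.sqrt T / Real.sqrt (-t) := by
  rintro t ⟨ht1, ht2⟩ y
  have hst : 0 < Real.sqrt (-t) := Real.sqrt_pos.2 (by linarith)
  have hsT : Real.sqrt (-t) ≤ Real.sqrt T := Real.sqrt_le_sqrt (by linarith)
  have hexp : Real.exp (-(4 * π ^ 2 * t)) ≤ Real.exp (4 * π ^ 2 * T) := by
    apply Real.exp_le_exp.2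
    nlinarith [pi_pos, sq_nonneg π]
  rw [le_div_iff₀ hst]
  calc ‖shearWave t y‖ * Real.sqrt (-t)
      ≤ Real.exp (4 * π ^ 2 * T) * Real.sqrt T := by
        gcongr
        exact (norm_shearWave_le t y).trans hexp

/-- **"Ancient" is load-bearing**: on every finite backward window the crux is false. Witness: the
viscous shear wave `e^{−4π²t} sin(2πy₀) e₁` — an exact smooth divergence-free NS solution, KNSS-mild
between any two times, Type-I on `(−T,0)` with `C = e^{4π²T}√T`, invariant under the translation
`(e₁, 0)`, and nonzero. It grows like `e^{4π²|t|}` as `t → −∞`, so it is no counterexample to the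
crux: a proof must use the behaviour of `u` as `t → −∞`. -/
theorem helicalEndLiouville_false_on_window {T : ℝ} (hT : 0 < T) : ¬ HelicalEndLiouvilleOnWindow T := by
  intro h
  have hT2 : -T / 2 ∈ Ioo (-T) 0 := ⟨by linarith, by linarith⟩
  exact shearWave_ne_zero (-T / 2) (h (Real.exp (4 * π ^ 2 * T) * Real.sqrt T) shearWave
    shearWave_contDiff.contDiffOn (fun t _ => shearWave_divFree t)
    (fun s t _ hst _ x => shearWave_mild s t hst x) shearWave_typeI_on_window e1 0 0 isSkew_zero
    (not_mem_range_zero e1_ne_zero) le_rfl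
    (fun t _ y => by simp [fderiv_shearWave_apply, e1_apply_zero]) (-T / 2) hT2 _)

/-! ### (d) `θ ≤ 0` (the end must lie inside the slab where the class constrains `u`) -/

/-- The crux with the hypothesis `θ ≤ 0` DROPPED. -/
def HelicalEndLiouvilleWithoutThetaNonpos : Prop :=
  ∀ (C : ℝ) (u : ℝ → ℝ³ → ℝ³), IsTypeIAncientMild C u →
    ∀ (a : ℝ³) (A : ℝ³ →L[ℝ] ℝ³) (θ : ℝ), IsSkew A → a ∉ Set.range A →
      HasKillingSymmetryBefore u a A θ → VanishesBefore u θ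

/-- The step field: `0` for `t < 0`, the constant `f₀` for `t ≥ 0` (where the class says nothing). -/
def stepField : ℝ → ℝ³ → ℝ³ := fun t _ => if t < 0 then 0 else f0

/-- The step field is a Type-I ancient mild field with `C = 0`: it is `0` on the slab `t < 0`. -/
theorem stepField_mem : IsTypeIAncientMild 0 stepField := by
  haveI : CompleteSpace ℝ³ := inferInstance
  have hslice : ∀ t < (0 : ℝ), stepField t = fun _ : ℝ³ => (0 : ℝ³) := fun t ht => by
    funext x; simp [stepField, ht]
  refine ⟨?_, fun t ht => ?_, fun s t hst ht x => ?_, fun t ht x => ?_⟩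
  · refine (contDiffOn_const (c := (0 : ℝ³))).congr ?_
    rintro ⟨t, x⟩ ⟨ht, -⟩
    simp only [mem_Iio] at ht
    simp [stepField, ht]
  · rw [hslice t ht]
    exact isDivFree_fun_const 0
  · have hs : s < 0 := hst.trans ht
    rw [hslice s hs, heatFlow_of_pos _ (sub_pos.2 hst),
      Literature.Analysis.UnboundedOperators.heatExtension_const _ (sub_pos.2 hst) x,
      oseenDuhamel_eq_zero_of_const (b := fun _ => (0 : ℝ³)) (c := fun _ => (0 : ℝ³))
        (fun τ hτ y => by rw [hslice τ (hτ.2.trans ht)]) (fun τ hτ y => by rw [hslice τ (hτ.2.trans ht)])]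
    simp [stepField, ht]
  · simp [stepField, ht]

/-- **`θ ≤ 0` is load-bearing only through the junk region `t ≥ 0`**: with `θ = 1` the step field
(in `A_0`, translation invariant at every time since every slice is spatially constant) does not
vanish at `t = 0`. Harmless; it records where the hypothesis enters (the end `t < θ` must lie in the
slab `t < 0` on which `IsTypeIAncientMild` constrains `u`). -/
theorem helicalEndLiouville_false_without_thetaNonpos : ¬ HelicalEndLiouvilleWithoutThetaNonpos := by
  intro h
  have key := h 0 stepField stepField_mem f0 0 1 isSkew_zero (not_mem_range_zero f0_ne_zero)
    (fun t _ x => by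
      have e : stepField t = fun _ : ℝ³ => (if t < 0 then (0 : ℝ³) else f0) := rfl
      rw [e]
      simp) 0 zero_lt_one 0
  simp [stepField] at key
  exact f0_ne_zero key

/-! ### (e) `a ∉ range A`: dropping it gives back exactly X -/

/-- The crux with `a ∉ range A` DROPPED (so `ξ = (a, A) = 0` is admitted). -/
def HelicalEndLiouvilleWithoutNotInRange : Prop :=
  ∀ (C : ℝ) (u : ℝ → ℝ³ → ℝ³), IsTypeIAncientMild C u →
    ∀ (a : ℝ³) (A : ℝ³ →L[ℝ] ℝ³) (θ : ℝ), IsSkew A → θ ≤ 0 →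
      HasKillingSymmetryBefore u a A θ → VanishesBefore u θ

/-- **Dropping `a ∉ range A` is dropping the whole crux structure**: the mutant is literally
equivalent to the route target `TypeIAncientLiouville` (take `ξ = 0`, `θ = 0`; conversely X kills
everything). Keeping `(a, A) ≠ 0` but allowing `a ∈ range A` adds exactly the axisymmetric leaf
`AxisymEndLiouville` (item 14061; the case split `hKill` of the route's `closes`). So the hypothesis
is load-bearing as a CASE SPLIT, not analytically. -/
theorem withoutNotInRange_iff_typeIAncientLiouville :
    HelicalEndLiouvilleWithoutNotInRange ↔ TypeIAncientLiouville := by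
  constructor
  · intro h C u hu t ht x
    exact h C u (isTypeIAncientMild_iff.2 hu) 0 0 0 isSkew_zero le_rfl (fun t _ x => by simp) t ht x
  · intro hX C u hu a A θ _ hθ _ t ht x
    exact hX C u (isTypeIAncientMild_iff.1 hu) t (lt_of_lt_of_le ht hθ) x

/-! ## §2 Tightness

Recorded by §1(b): with the decay relaxed to boundedness (even keeping Type-I near `t = 0`) the
best possible conclusion is "`u` is a constant vector of `ker A`" — attained by `c ∈ ker A`
(translations: every constant; screws: constants along the axis). No finer quantitative tightness
statement is meaningful here: the conclusion is `u ≡ 0`. -/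

/-! ## §3 Natural strengthenings: none is refutable short of refuting X

Every statement of the shape "`u ∈ A_C` + (any extra hypothesis about `u`, `θ`) ⇒ `u ≡ 0` on
`t < θ`" is a corollary of `TypeIAncientLiouville`. This covers: symmetry only on a final window,
a single DISCRETE screw/translation (the periodic leaf `PeriodicEndLiouville`), `A` not skew,
`a ∈ range A` with `A ≠ 0` (item 14061), conclusion on all `t < 0`, … A refutation of any of them
exhibits a nonzero element of `A_C`, i.e. refutes (L') in the KNSS gauge — open (KNSS 2009 §6;
Bradshaw–Tsai 2017 OP 5.1; Tsai 2018 Conj. 8.8–8.9). -/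

/-- **Every in-class end-statement is a corollary of X** (formal version of §3). -/
theorem endStatement_of_typeIAncientLiouville (P : (ℝ → ℝ³ → ℝ³) → ℝ → Prop)
    (hX : TypeIAncientLiouville) :
    ∀ (C : ℝ) (u : ℝ → ℝ³ → ℝ³), IsTypeIAncientMild C u → ∀ θ ≤ (0 : ℝ), P u θ →
      VanishesBefore u θ :=
  fun C u hu _ hθ _ t ht x => hX C u (isTypeIAncientMild_iff.1 hu) t (lt_of_lt_of_le ht hθ) x

/-! ## §4 What is provable now (POSITIVE — evidence for the prover, not a Negative/ lemma)

The translational leaf along the coordinate axis `x₂` (Lean index `1`) follows from the PROVED tree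
theorem `KNSS2009_typeI_rate_liouville_holds` (KNSS 2009, proof of Thm 6.2: an `x₂`-independent
bounded ancient Oseen-mild field with `√(−t)‖W‖ ≤ C` vanishes): shift `u` into the past by
`σ ∈ (−θ, −t₀)` to make it bounded on `t < 0` (`IsTypeIAncientMild.comp_sub_right`, bound `C/√σ`)
and symmetric on all of `t < 0`, and integrate the infinitesimal symmetry along the lines
`x + r a`. The general direction `a ≠ 0` needs only rotation covariance of the Oseen class
(`oseenKernel` is built from inner products; `heatKernel` is radial) — not yet a tree lemma. -/

/-- Infinitesimal ⇒ finite translation invariance along a line, for a differentiable slice. -/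
theorem eq_of_fderiv_apply_eq_zero {f : ℝ³ → ℝ³} (hf : Differentiable ℝ f) {a : ℝ³}
    (h : ∀ x, fderiv ℝ f x a = 0) (x : ℝ³) (r : ℝ) : f (x + r • a) = f x := by
  set g : ℝ → ℝ³ := fun r => f (x + r • a) with hg
  have hderiv : ∀ r, HasDerivAt g 0 r := by
    intro r
    have hp : HasDerivAt (fun r : ℝ => x + r • a) a r := by
      simpa using ((hasDerivAt_id r).smul_const a).const_add x
    have hcomp : HasDerivAt (f ∘ fun r : ℝ => x + r • a) (fderiv ℝ f (x + r • a) a) r :=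
      (hf (x + r • a)).hasFDerivAt.comp_hasDerivAt r hp
    rw [h (x + r • a)] at hcomp
    exact hcomp
  have hdiff : Differentiable ℝ g := fun r => (hderiv r).differentiableAt
  have hconst := is_const_of_deriv_eq_zero hdiff (fun r => (hderiv r).deriv) r 0
  simpa [hg] using hconst

/-- **Translational leaf along `x₂`, PROVED** from `KNSS2009_typeI_rate_liouville_holds`: a Type-I
ancient mild field invariant on an end `t < θ ≤ 0` under the translations generated by
`a = c e₂`, `c ≠ 0`, vanishes on that end. (Positive; the case `A = 0`, `a ∥ e₂` of the crux.) -/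
theorem translationLeaf_axis1 {C : ℝ} {u : ℝ → ℝ³ → ℝ³} (hu : IsTypeIAncientMild C u)
    {θ : ℝ} (hθ : θ ≤ 0) {c : ℝ} (hc : c ≠ 0)
    (hsym : ∀ t < θ, ∀ x, fderiv ℝ (u t) x (EuclideanSpace.single 1 c) = 0) :
    ∀ t < θ, ∀ x, u t x = 0 := by
  intro t₀ ht₀ x₀
  -- shift into the past by σ ∈ (−θ, −t₀)
  set σ : ℝ := (-θ - t₀) / 2 with hσ
  have hσθ : -θ < σ := by rw [hσ]; linarith
  have hσ0 : 0 < σ := lt_of_le_of_lt (neg_nonneg.2 hθ) hσθ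
  have hσt : t₀ + σ < 0 := by rw [hσ]; linarith
  set v : ℝ → ℝ³ → ℝ³ := fun t => u (t - σ) with hv
  have hvmem : IsTypeIAncientMild C v := hu.comp_sub_right hσ0.le
  have hC : 0 ≤ C := hu.nonneg
  -- the hypotheses of the tree theorem
  have h1 : ContinuousOn (uncurry v) (Iio 0 ×ˢ univ) := hvmem.continuousOn_uncurry
  have h2 : ∃ K : ℝ, ∀ t < 0, ∀ x, ‖v t x‖ ≤ K := by
    refine ⟨C / Real.sqrt σ, fun t ht x => ?_⟩
    have key := hu.norm_le (t := t - σ) (by linarith) x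
    refine key.trans ?_
    exact div_le_div_of_nonneg_left hC (Real.sqrt_pos.2 hσ0) (Real.sqrt_le_sqrt (by linarith))
  have h3 : ∀ t < 0, IsWeaklyDivFree (v t) := fun t ht => hvmem.isWeaklyDivFree ht
  have h4 : ∀ s t : ℝ, s < t → t < 0 → ∀ x,
      v t x = Literature.Analysis.UnboundedOperators.heatExtension (v s) (t - s) x -
        oseenDuhamel 1 s v v t x :=
    fun s t hst ht x => hvmem.mild_eq_heatExtension hst ht x
  have h5 : ∀ t < 0, ∀ (x : ℝ³) (δ : ℝ), v t (x + EuclideanSpace.single 1 δ) = v t x := by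
    intro t ht x δ
    have htσ : t - σ < θ := by linarith
    have hdiff : Differentiable ℝ (u (t - σ)) :=
      (hu.contDiff_slice (by linarith)).differentiable (by simp)
    have key := eq_of_fderiv_apply_eq_zero hdiff (hsym (t - σ) htσ) x (δ / c)
    have e : (δ / c) • EuclideanSpace.single (1 : Fin 3) c = EuclideanSpace.single 1 δ := by
      ext i
      by_cases hi : i = 1
      · subst hi; simp [div_mul_cancel₀ δ hc]
      · simp [hi]
    simpa [hv, e] using key
  have h6 : ∀ t < 0, ∀ x, Real.sqrt (-t) * ‖v t x‖ ≤ C := by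
    intro t ht x
    have hs : 0 < Real.sqrt (-t) := Real.sqrt_pos.2 (by linarith)
    have key := hvmem.norm_le ht x
    rw [le_div_iff₀ hs] at key
    linarith [mul_comm (Real.sqrt (-t)) ‖v t x‖]
  have hzero := KNSS2009_typeI_rate_liouville_holds h1 h2 h3 h4 h5 h6 (t₀ + σ) hσt x₀
  simpa [hv] using hzero

/-- The translational `x₂`-leaf in the exact shape of the crux (`A = 0`, `a = c e₂`). -/
theorem helicalEndLiouvilleLocal_translation_axis1 :
    ∀ (C : ℝ) (u : ℝ → ℝ³ → ℝ³), IsTypeIAncientMild C u →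
      ∀ (c θ : ℝ), c ≠ 0 → θ ≤ 0 →
        HasKillingSymmetryBefore u (EuclideanSpace.single 1 c) 0 θ → VanishesBefore u θ := by
  intro C u hu c θ hc hθ hsym
  refine translationLeaf_axis1 hu hθ hc fun t ht x => ?_
  simpa using hsym t ht x

/-! ## The translational leaf in every direction (rotation covariance + the `x₂` leaf) -/

/-- The Fréchet derivative of a conjugate slice. -/
theorem hasFDerivAt_conj (L : ℝ³ ≃ₗᵢ[ℝ] ℝ³) {φ : ℝ³ → ℝ³} (hd : Differentiable ℝ φ) (y : ℝ³) :
    HasFDerivAt (fun z => L (φ (L.symm z)))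
      ((L.toContinuousLinearEquiv : ℝ³ →L[ℝ] ℝ³).comp ((fderiv ℝ φ (L.symm y)).comp
        (L.symm.toContinuousLinearEquiv : ℝ³ →L[ℝ] ℝ³))) y := by
  have hA : HasFDerivAt (fun z : ℝ³ => L.symm z) (L.symm.toContinuousLinearEquiv : ℝ³ →L[ℝ] ℝ³) y :=
    L.symm.toContinuousLinearEquiv.hasFDerivAt
  have hB : HasFDerivAt φ (fderiv ℝ φ (L.symm y)) (L.symm y) := (hd _).hasFDerivAt
  have hC : HasFDerivAt (fun z : ℝ³ => L z) (L.toContinuousLinearEquiv : ℝ³ →L[ℝ] ℝ³)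
      (φ (L.symm y)) := L.toContinuousLinearEquiv.hasFDerivAt
  exact (hC.comp (L.symm y) hB).comp y hA

/-- A linear isometry of `ℝ³` taking `a ≠ 0` to `‖a‖ e₂` (a Householder reflection). -/
theorem exists_linearIsometryEquiv_map_eq_single (a : ℝ³) :
    ∃ L : ℝ³ ≃ₗᵢ[ℝ] ℝ³, L a = EuclideanSpace.single 1 ‖a‖ := by
  have hn : ‖a‖ = ‖(EuclideanSpace.single (1 : Fin 3) ‖a‖ : ℝ³)‖ := by
    simp
  exact ⟨_, Submodule.reflection_sub hn⟩

/-- **The translational leaf of the crux, every direction** (positive; `A = 0`, `a ≠ 0`): a Type-I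
ancient mild field invariant on an end `t < θ ≤ 0` under the translations along `a` vanishes there.
Proof: rotate `a` onto `‖a‖ e₂` (`A_C` is rotation invariant, `isTypeIAncientMild_conjField`) and
apply the `x₂`-leaf `translationLeaf_axis1` (= `KNSS2009_typeI_rate_liouville_holds`). -/
theorem translationLeaf {C : ℝ} {u : ℝ → ℝ³ → ℝ³} (hu : IsTypeIAncientMild C u)
    {θ : ℝ} (hθ : θ ≤ 0) {a : ℝ³} (ha : a ≠ 0)
    (hsym : ∀ t < θ, ∀ x, fderiv ℝ (u t) x a = 0) : ∀ t < θ, ∀ x, u t x = 0 := by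
  obtain ⟨L, hL⟩ := exists_linearIsometryEquiv_map_eq_single a
  have hv : IsTypeIAncientMild C (conjField L u) := isTypeIAncientMild_conjField hu L
  have hc : ‖a‖ ≠ 0 := norm_ne_zero_iff.2 ha
  have hsymv : ∀ t < θ, ∀ y, fderiv ℝ (conjField L u t) y (EuclideanSpace.single 1 ‖a‖) = 0 := by
    intro t ht y
    have hd : Differentiable ℝ (u t) :=
      (hu.contDiff_slice (lt_of_lt_of_le ht hθ)).differentiable (by simp)
    have e : conjField L u t = fun z => L (u t (L.symm z)) := rfl
    rw [e, (hasFDerivAt_conj L hd y).fderiv, ← hL]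
    simp [hsym t ht (L.symm y)]
  intro t ht x
  have key := translationLeaf_axis1 hv hθ hc hsymv t ht (L x)
  simpa using key

/-- **The case `A = 0` of the crux (`HelicalEndLiouvilleLocal` with `A = 0`), PROVED, exact shape.** -/
theorem helicalEndLiouvilleLocal_translation_case :
    ∀ (C : ℝ) (u : ℝ → ℝ³ → ℝ³), IsTypeIAncientMild C u →
      ∀ (a : ℝ³) (θ : ℝ), a ∉ Set.range ((0 : ℝ³ →L[ℝ] ℝ³) : ℝ³ → ℝ³) → θ ≤ 0 →
        (∀ t < θ, ∀ x, fderiv ℝ (u t) x (a + (0 : ℝ³ →L[ℝ] ℝ³) x) - (0 : ℝ³ →L[ℝ] ℝ³) (u t x) = 0) →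
        ∀ t < θ, ∀ x, u t x = 0 := by
  intro C u hu a θ ha hθ hsym
  have ha0 : a ≠ 0 := by
    rintro rfl
    exact ha ⟨0, by simp⟩
  refine translationLeaf hu hθ ha0 fun t ht x => ?_
  simpa using hsym t ht x


/-! ### §4b The "Kato gap" of the route's proof plan is already a tree theorem

`Theorems.exists_typeIAncientMild_eq_zero_of_small` (Leray's lower blow-up-rate bound in ancient
form): `A_C = {0}` for `C ≤ ε`. Shifted onto an end it gives the GAP DICHOTOMY below: an element of
`A_C` is either `0` on the end `t < θ`, or `sup_{τ<t} √(−τ)‖u(τ)‖_∞ > ε` for EVERY `t ≤ θ`, i.e.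
`limsup_{τ→−∞} √(−τ)‖u(τ)‖_∞ ≥ ε`. So the helical leaf is EQUIVALENT to: "no screw-symmetric element
of `A_C` keeps `√(−t)‖u(t)‖_∞ ≥ ε` along a sequence `t_n → −∞`" — and near-maximisers of such an
element are exactly the centres of the route's zoom-out. What remains for the prover is ONLY the
compactness/mild-closure of `A_C` under `λ u(λ²s, x_n + λy)` (KNSS Lemma 6.1 for this class). -/

/-- **Gap dichotomy on an end** (positive; from `exists_typeIAncientMild_eq_zero_of_small` by a
time shift): there is a universal `ε > 0` such that an element of `A_C` with
`√(−t)‖u(t,x)‖ ≤ ε` on an end `t < θ ≤ 0` vanishes on that end. -/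
theorem gap_dichotomy_on_end :
    ∃ ε : ℝ, 0 < ε ∧ ∀ (C : ℝ) (u : ℝ → ℝ³ → ℝ³), IsTypeIAncientMild C u → ∀ θ ≤ (0 : ℝ),
      (∀ t < θ, ∀ x, Real.sqrt (-t) * ‖u t x‖ ≤ ε) → VanishesBefore u θ := by
  obtain ⟨ε, hε, hsmall⟩ :=
    Summit.NavierStokesRegularity.NavierStokesRegularity.Theorems.exists_typeIAncientMild_eq_zero_of_small
  refine ⟨ε, hε, fun C u hu θ hθ hend t ht x => ?_⟩
  -- shift the end onto `t < 0`
  set v : ℝ → ℝ³ → ℝ³ := fun s => u (s - (-θ)) with hv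
  have hvmem : IsTypeIAncientMild C v := hu.comp_sub_right (neg_nonneg.2 hθ)
  have hvε : IsTypeIAncientMild ε v := by
    refine ⟨hvmem.1, hvmem.2.1, hvmem.2.2.1, fun s hs y => ?_⟩
    have hsθ : s - (-θ) < θ := by linarith
    have key := hend (s - (-θ)) hsθ y
    have hpos : 0 < Real.sqrt (-(s - (-θ))) := Real.sqrt_pos.2 (by linarith)
    have hs0 : 0 < Real.sqrt (-s) := Real.sqrt_pos.2 (by linarith)
    have h1 : ‖u (s - (-θ)) y‖ ≤ ε / Real.sqrt (-(s - (-θ))) := by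
      rw [le_div_iff₀ hpos, mul_comm]; exact key
    refine h1.trans ?_
    exact div_le_div_of_nonneg_left hε.le hs0 (Real.sqrt_le_sqrt (by linarith))
  have hzero := hsmall ε v hvε le_rfl (t + (-θ)) (by linarith) x
  simpa [hv] using hzero

/-- **Boundary: the perturbative regime is empty.** For `C ≤ ε` the crux holds for trivial reasons
(`A_C = {0}`, tree theorem `exists_typeIAncientMild_eq_zero_of_small`); its content sits entirely at
LARGE Type-I constants, where no contraction argument is available — and where no element is known. -/
theorem helicalEndLiouvilleLocal_small :
    ∃ ε : ℝ, 0 < ε ∧ ∀ (C : ℝ), C ≤ ε → ∀ (u : ℝ → ℝ³ → ℝ³), IsTypeIAncientMild C u →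
      ∀ (a : ℝ³) (A : ℝ³ →L[ℝ] ℝ³) (θ : ℝ), θ ≤ 0 →
        HasKillingSymmetryBefore u a A θ → VanishesBefore u θ := by
  obtain ⟨ε, hε, hsmall⟩ :=
    Summit.NavierStokesRegularity.NavierStokesRegularity.Theorems.exists_typeIAncientMild_eq_zero_of_small
  exact ⟨ε, hε, fun C hC u hu a A θ hθ _ t ht x => hsmall C u hu hC t (lt_of_lt_of_le ht hθ) x⟩

/-! ## §5 Targets (lead's stuck stubs) — none yet (payload.targets = []). -/

/-! ## §6 Near-misses — none: no candidate counter-model inside `A_C` exists to formalise. -/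

end Summit.NavierStokesRegularity.NavierStokesRegularity.Cruxes.HelicalEndLiouville.Disproof

end
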